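import Literature.NumberTheory.ConnesConsani2023.ZetaCycles
import HarnessLib

/-!
# ζ-cycles: the regular representation of `C_μ` on `L²(C_μ)` and Lemma 6.2 (ii) of Connes–Consani 2023

RH-FREE corpus literature (Connes–Consani 2023, *Spectral triples and ζ-cycles*, §6; cell rh-crit C1,
row t11).  Sequel of `ZetaCycles.lean` (statements).  Everything here is PROVED; no new named facts.  This
file DISCHARGES `CC2023_lemma_6_2_ii` of `ZetaCycles.lean`.  Nothing in this file bears on the truth of RH.

* `rotateLp` calculus (the regular representation `R_a` of the circle `C = ℝ/Lℤ ≅ C_μ`, `L = log μ`, on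
  `L²(C)`, read additively): a.e. formula, `R_{-a} ∘ R_a = id`, rotations are isometries, `R_a e_n = e_n(−a) e_n`;
* **characters in closed invariant subspaces** (the "direct sum of unitary characters" step of the
  proof of Theorem 6.4 (i), p0019:L18, i.e. Peter–Weyl for the circle group): a closed rotation-invariant
  subspace `H ≠ 0` of `L²(C)` whose orthogonal complement is also invariant contains a character
  `fourierLp 2 n` (the orthogonal projection onto `H` commutes with rotations, hence maps each character
  to a multiple of itself; if all these multiples vanished, `H` would be orthogonal to the dense span of
  the characters); and a vector of `H` is orthogonal to every character not in `H`;
* **Lemma 6.2 (ii)**: `R_a (Σ_μ 𝓔(𝒮^ev_0)) = Σ_μ 𝓔(𝒮^ev_0)` — the rotation of the class of `Σ_μ 𝓔(f)` is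
  `λ^{-1/2}` times the class of `Σ_μ 𝓔(ϑ(λ) f)`, `a = log λ` (Lemma 6.2 (i), `sigmaE_schwartzScale`);
  consequently `𝓗(L) = Σ_μ 𝓔(𝒮^ev_0)^⊥` is rotation invariant and, if nonzero, contains a character.

Corollary 6.5 and Proposition 6.3 (which also need Theorem 6.4) are in `ZetaCyclesSpectrum.lean`.

## References

* A. Connes, C. Consani, *Spectral triples and ζ-cycles*, Enseign. Math. 69 (2023) 93–148,
  arXiv:2106.01715, §6, Lemma 6.2, proof of Theorem 6.4 (i), Corollary 6.5 [ConnesConsani2023].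
-/

noncomputable section

open scoped Topology SchwartzMap ENNReal ComplexConjugate
open Function Filter MeasureTheory Complex Set AddCircle
open Literature.NumberTheory.LFunctions

namespace Literature.NumberTheory.ConnesConsani2023.ZetaCycles

section Rotations

variable {L : ℝ} [hL : Fact (0 < L)]

/-! ### Rotations of `L²(C)` -/

/-- A.e. formula: `(R_a ξ)(x) = ξ(−a + x)` (the regular representation of `C_μ` on `L²(C_μ)`, read additively). [cite: ConnesConsani2023, §6.2 scaling action ϑ and Lemma 6.2 (ii) (arXiv chunk p0018:L60, L69)] -/
theorem coeFn_rotateLp (a : AddCircle L) (ξ : Lp ℂ 2 (@haarAddCircle L hL)) :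
    (rotateLp L a ξ : AddCircle L → ℂ) =ᵐ[haarAddCircle] fun x => ξ (-a + x) :=
  Lp.coeFn_compMeasurePreserving ξ (measurePreserving_add_left haarAddCircle (-a))

/-- Transport of an a.e. equality along a rotation. [folklore] -/
private theorem ae_eq_comp_rotate {g g' : AddCircle L → ℂ} (a : AddCircle L)
    (h : g =ᵐ[haarAddCircle] g') :
    (fun x => g (-a + x)) =ᵐ[(haarAddCircle : Measure (AddCircle L))] fun x => g' (-a + x) :=
  (measurePreserving_add_left haarAddCircle (-a)).quasiMeasurePreserving.ae_eq_comp h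

/-- `R_{b} (R_a ξ) = R_{a+b} ξ`… in the form needed here: `R_{-a} (R_a ξ) = ξ`. [cite: ConnesConsani2023, §6.2 scaling action ϑ and Lemma 6.2 (ii) (arXiv chunk p0018:L60, L69)] -/
theorem rotateLp_neg_rotateLp (a : AddCircle L) (ξ : Lp ℂ 2 (@haarAddCircle L hL)) :
    rotateLp L (-a) (rotateLp L a ξ) = ξ := by
  apply Lp.ext
  have h1 := coeFn_rotateLp (-a) (rotateLp L a ξ)
  have h2 := ae_eq_comp_rotate (-a) (coeFn_rotateLp a ξ)
  filter_upwards [h1, h2] with x hx1 hx2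
  rw [hx1, hx2]
  simp only [neg_neg, neg_add_cancel_left]

/-- Rotations preserve inner products (the regular representation is unitary). [cite: ConnesConsani2023, §6.2 scaling action ϑ and Lemma 6.2 (ii) (arXiv chunk p0018:L60, L69)] -/
theorem inner_rotateLp (a : AddCircle L) (ξ η : Lp ℂ 2 (@haarAddCircle L hL)) :
    inner ℂ (rotateLp L a ξ) (rotateLp L a η) = inner ℂ ξ η :=
  (rotateLp L a).inner_map_map ξ η

/-- If a subspace `K` is invariant under all rotations, so is `Kᗮ`
(`⟪u, R_a v⟫ = ⟪R_{-a} u, v⟫`). [cite: ConnesConsani2023, §6.2 scaling action ϑ and Lemma 6.2 (ii) (arXiv chunk p0018:L60, L69)] -/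
theorem rotateLp_mem_orthogonal {K : Submodule ℂ (Lp ℂ 2 (@haarAddCircle L hL))}
    (hK : ∀ (a : AddCircle L), ∀ u ∈ K, rotateLp L a u ∈ K) (a : AddCircle L)
    {v : Lp ℂ 2 (@haarAddCircle L hL)} (hv : v ∈ Kᗮ) : rotateLp L a v ∈ Kᗮ := by
  rw [Submodule.mem_orthogonal] at hv ⊢
  intro u hu
  rw [← inner_rotateLp (-a), rotateLp_neg_rotateLp]
  exact hv _ (hK (-a) u hu)

/-- Rotating a character multiplies it by a unimodular constant: `R_a e_n = e_n(−a) · e_n` (the characters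
`u^{is}`, `μ^{is} = 1`, of `C_μ`, proof of Theorem 6.4 (i)). [cite: ConnesConsani2023, proof of Theorem 6.4 (i) (arXiv chunk p0019:L18–L20)] -/
theorem rotateLp_fourierLp (a : AddCircle L) (n : ℤ) :
    rotateLp L a (fourierLp 2 n : Lp ℂ 2 (@haarAddCircle L hL)) =
      (fourier n (-a) : ℂ) • (fourierLp 2 n : Lp ℂ 2 (@haarAddCircle L hL)) := by
  apply Lp.ext
  have h1 := coeFn_rotateLp a (fourierLp 2 n : Lp ℂ 2 (@haarAddCircle L hL))
  have h2 := ae_eq_comp_rotate a (coeFn_fourierLp (T := L) 2 n)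
  have h3 := Lp.coeFn_smul (fourier n (-a) : ℂ) (fourierLp 2 n : Lp ℂ 2 (@haarAddCircle L hL))
  filter_upwards [h1, h2, h3, coeFn_fourierLp (T := L) 2 n] with x hx1 hx2 hx3 hx4
  rw [hx1, hx2, hx3, Pi.smul_apply, hx4, smul_eq_mul]
  simp only [fourier_apply, zsmul_add, toCircle_add, Circle.coe_mul]

/-- For `k ≠ 0` the character `fourier k` is not identically `1`: at `x = L/(2k)` it equals `−1`.
[folklore] -/
private theorem exists_fourier_ne_one {k : ℤ} (hk : k ≠ 0) : ∃ a : AddCircle L, fourier k a ≠ 1 := by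
  refine ⟨((L / (2 * k) : ℝ) : AddCircle L), ?_⟩
  rw [fourier_coe_apply]
  have hk' : (k : ℂ) ≠ 0 := by exact_mod_cast hk
  have hL' : (L : ℂ) ≠ 0 := ofReal_ne_zero.2 hL.out.ne'
  have h : 2 * (Real.pi : ℂ) * I * k * ((L / (2 * k) : ℝ) : ℂ) / L = Real.pi * I := by
    push_cast
    field_simp
  rw [h, Complex.exp_pi_mul_I]
  norm_num

/-! ### Characters in closed rotation-invariant subspaces -/

/-- **The orthogonal projection onto a rotation-invariant closed subspace maps each character to a
multiple of itself** (Peter–Weyl for the circle; the "direct sum of unitary characters" step of the proof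
of Theorem 6.4 (i), p0019:L18): if `H` and `Hᗮ` are invariant under all rotations, then
`P e_n = ⟪e_n, P e_n⟫ e_n`.  Proof: `P` commutes with rotations, so `R_a (P e_n) = e_n(−a) P e_n`;
comparing Fourier coefficients (`e_m(−a) ≠ e_n(−a)` for some `a` when `m ≠ n`) all coefficients of `P e_n`
but the `n`-th vanish. [cite: ConnesConsani2023, proof of Theorem 6.4 (i) (arXiv chunk p0019:L18)] -/
theorem starProjection_fourierLp_eq_smul (H : Submodule ℂ (Lp ℂ 2 (@haarAddCircle L hL)))
    [H.HasOrthogonalProjection]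
    (hH : ∀ (a : AddCircle L), ∀ u ∈ H, rotateLp L a u ∈ H)
    (hH' : ∀ (a : AddCircle L), ∀ u ∈ Hᗮ, rotateLp L a u ∈ Hᗮ) (n : ℤ) :
    H.starProjection (fourierLp 2 n : Lp ℂ 2 (@haarAddCircle L hL)) =
      (inner ℂ (fourierLp 2 n : Lp ℂ 2 (@haarAddCircle L hL))
        (H.starProjection (fourierLp 2 n : Lp ℂ 2 (@haarAddCircle L hL)))) •
        (fourierLp 2 n : Lp ℂ 2 (@haarAddCircle L hL)) := by
  classical
  -- `P` commutes with rotations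
  have hcomm : ∀ (a : AddCircle L) (v : Lp ℂ 2 (@haarAddCircle L hL)),
      H.starProjection (rotateLp L a v) = rotateLp L a (H.starProjection v) := by
    intro a v
    refine Submodule.eq_starProjection_of_mem_orthogonal (hH a _ (H.starProjection_apply_mem v)) ?_
    have h := hH' a _ (H.sub_starProjection_mem_orthogonal v)
    rwa [map_sub] at h
  -- hence `P e_n` transforms under rotations like `e_n`
  have heig : ∀ (a : AddCircle L),
      rotateLp L a (H.starProjection (fourierLp 2 n : Lp ℂ 2 (@haarAddCircle L hL))) =
        (fourier n (-a) : ℂ) • H.starProjection (fourierLp 2 n : Lp ℂ 2 (@haarAddCircle L hL)) := by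
    intro a
    rw [← hcomm, rotateLp_fourierLp, map_smul]
  -- characters evaluated at `-a` versus `a`
  have hconj : ∀ (m : ℤ) (a : AddCircle L), conj (fourier m (-a) : ℂ) = fourier m a := by
    intro m a
    rw [← fourier_neg]
    simp only [fourier_apply, neg_zsmul, zsmul_neg, neg_neg]
  set w := H.starProjection (fourierLp 2 n : Lp ℂ 2 (@haarAddCircle L hL)) with hw
  -- Fourier coefficients of `P e_n` off the diagonal vanish
  have hcoef : ∀ m : ℤ, m ≠ n → inner ℂ (fourierLp 2 m : Lp ℂ 2 (@haarAddCircle L hL)) w = 0 := by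
    intro m hmn
    obtain ⟨a, ha⟩ := exists_fourier_ne_one (L := L) (sub_ne_zero.2 hmn)
    -- `⟪e_m, R_{-a} w⟫` computed in two ways
    have h1 : inner ℂ (fourierLp 2 m : Lp ℂ 2 (@haarAddCircle L hL)) (rotateLp L (-a) w) =
        (fourier n a : ℂ) * inner ℂ (fourierLp 2 m : Lp ℂ 2 (@haarAddCircle L hL)) w := by
      rw [heig (-a), neg_neg, inner_smul_right]
    have h2 : inner ℂ (fourierLp 2 m : Lp ℂ 2 (@haarAddCircle L hL)) (rotateLp L (-a) w) =
        (fourier m a : ℂ) * inner ℂ (fourierLp 2 m : Lp ℂ 2 (@haarAddCircle L hL)) w := by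
      rw [← inner_rotateLp a (fourierLp 2 m : Lp ℂ 2 (@haarAddCircle L hL)) (rotateLp L (-a) w)]
      have : rotateLp L a (rotateLp L (-a) w) = w := by
        simpa only [neg_neg] using rotateLp_neg_rotateLp (-a) w
      rw [this, rotateLp_fourierLp, inner_smul_left, hconj]
    have h3 : ((fourier m a : ℂ) - fourier n a) * inner ℂ (fourierLp 2 m : Lp ℂ 2 (@haarAddCircle L hL)) w
        = 0 := by
      rw [sub_mul, ← h2, ← h1, sub_self]
    rcases mul_eq_zero.1 h3 with h | h
    · exfalso
      apply ha
      have hna : (fourier n a : ℂ) ≠ 0 := by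
        rw [fourier_apply]; exact Circle.coe_ne_zero _
      have heq : (fourier m a : ℂ) = fourier n a := sub_eq_zero.1 h
      have h4 : (fourier (m - n) a : ℂ) * fourier n a = fourier n a := by
        rw [← fourier_add, sub_add_cancel, heq]
      exact (mul_eq_right₀ hna).1 h4
    · exact h
  -- so `P e_n = c_n • e_n` with `c_n = ⟪e_n, P e_n⟫`
  set c : ℂ := inner ℂ (fourierLp 2 n : Lp ℂ 2 (@haarAddCircle L hL)) w with hc
  have hzero : (fourierBasis (T := L)).repr (w - c • fourierLp 2 n) = 0 := by
    ext m
    rw [HilbertBasis.repr_apply_apply, coe_fourierBasis, lp.coeFn_zero, Pi.zero_apply,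
      inner_sub_right, inner_smul_right]
    by_cases hmn : m = n
    · subst hmn
      have h1 : inner ℂ (fourierLp 2 m : Lp ℂ 2 (@haarAddCircle L hL)) (fourierLp 2 m) = 1 := by
        have := (orthonormal_fourier (T := L)).1 m
        rw [inner_self_eq_norm_sq_to_K, this]; norm_num
      rw [h1, mul_one, hc, sub_self]
    · rw [hcoef m hmn]
      have h0 : inner ℂ (fourierLp 2 m : Lp ℂ 2 (@haarAddCircle L hL)) (fourierLp 2 n) = 0 :=
        (orthonormal_fourier (T := L)).2 hmn
      rw [h0, mul_zero, sub_zero]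
  have : w - c • fourierLp 2 n = 0 := by
    rwa [LinearIsometryEquiv.map_eq_zero_iff] at hzero
  exact (sub_eq_zero.1 this)

/-- Consequently a vector of `H` is orthogonal to every character NOT in `H` (the characters in `H` span
it). [cite: ConnesConsani2023, proof of Theorem 6.4 (i) (arXiv chunk p0019:L18)] -/
theorem inner_fourierLp_eq_zero_of_not_mem (H : Submodule ℂ (Lp ℂ 2 (@haarAddCircle L hL)))
    [H.HasOrthogonalProjection]
    (hH : ∀ (a : AddCircle L), ∀ u ∈ H, rotateLp L a u ∈ H)
    (hH' : ∀ (a : AddCircle L), ∀ u ∈ Hᗮ, rotateLp L a u ∈ Hᗮ) {n : ℤ}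
    (hn : (fourierLp 2 n : Lp ℂ 2 (@haarAddCircle L hL)) ∉ H) {v : Lp ℂ 2 (@haarAddCircle L hL)}
    (hv : v ∈ H) : inner ℂ (fourierLp 2 n : Lp ℂ 2 (@haarAddCircle L hL)) v = 0 := by
  have hPe := starProjection_fourierLp_eq_smul H hH hH' n
  set c : ℂ := inner ℂ (fourierLp 2 n : Lp ℂ 2 (@haarAddCircle L hL))
    (H.starProjection (fourierLp 2 n : Lp ℂ 2 (@haarAddCircle L hL))) with hc
  have hc1 : c ≠ 1 := by
    intro h1
    apply hn
    rw [← Submodule.starProjection_eq_self_iff, hPe, h1, one_smul]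
  have h : inner ℂ (fourierLp 2 n : Lp ℂ 2 (@haarAddCircle L hL)) v =
      conj c * inner ℂ (fourierLp 2 n : Lp ℂ 2 (@haarAddCircle L hL)) v := by
    conv_lhs => rw [← Submodule.starProjection_eq_self_iff.2 hv, ← Submodule.inner_starProjection_left_eq_right,
      hPe, inner_smul_left]
  have h2 : (1 - conj c) * inner ℂ (fourierLp 2 n : Lp ℂ 2 (@haarAddCircle L hL)) v = 0 := by
    rw [sub_mul, one_mul, ← h, sub_self]
  rcases mul_eq_zero.1 h2 with h3 | h3
  · exfalso
    apply hc1
    have : conj c = 1 := (sub_eq_zero.1 h3).symm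
    simpa using congrArg conj this
  · exact h3

/-- **Peter–Weyl for the circle, the case needed in the proof of Theorem 6.4 (i)**: a closed subspace
`H ≠ 0` of `L²(C)` such that `H` and `Hᗮ` are invariant under all rotations contains one of the characters
`e_n` (if all `P e_n = 0` then every `e_n ∈ Hᗮ`, whose closed span is everything, so `H = 0`).
[cite: ConnesConsani2023, proof of Theorem 6.4 (i) (arXiv chunk p0019:L18)] -/
theorem exists_fourierLp_mem_of_rotation_invariant (H : Submodule ℂ (Lp ℂ 2 (@haarAddCircle L hL)))
    [H.HasOrthogonalProjection]
    (hH : ∀ (a : AddCircle L), ∀ u ∈ H, rotateLp L a u ∈ H)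
    (hH' : ∀ (a : AddCircle L), ∀ u ∈ Hᗮ, rotateLp L a u ∈ Hᗮ) (hne : H ≠ ⊥) :
    ∃ n : ℤ, (fourierLp 2 n : Lp ℂ 2 (@haarAddCircle L hL)) ∈ H := by
  classical
  have hPe := starProjection_fourierLp_eq_smul H hH hH'
  -- if all `c_n = 0`, every character is in `Hᗮ`, hence `H = ⊥`
  by_contra hnone
  push Not at hnone
  apply hne
  have hall : ∀ n : ℤ, (fourierLp 2 n : Lp ℂ 2 (@haarAddCircle L hL)) ∈ Hᗮ := by
    intro n
    rw [← Submodule.starProjection_apply_eq_zero_iff]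
    by_contra hPn
    apply hnone n
    set c : ℂ := inner ℂ (fourierLp 2 n : Lp ℂ 2 (@haarAddCircle L hL))
      (H.starProjection (fourierLp 2 n : Lp ℂ 2 (@haarAddCircle L hL))) with hc
    have hc0 : c ≠ 0 := by
      intro h0
      apply hPn
      rw [hPe n, ← hc, h0, zero_smul]
    have hmem : c⁻¹ • H.starProjection (fourierLp 2 n : Lp ℂ 2 (@haarAddCircle L hL)) ∈ H :=
      H.smul_mem _ (H.starProjection_apply_mem _)
    rw [hPe n, ← hc, smul_smul, inv_mul_cancel₀ hc0, one_smul] at hmem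
    exact hmem
  -- `span (range e) ≤ Hᗮ`, closure is `⊤`
  have hspan : (Submodule.span ℂ (Set.range (@fourierLp L hL 2 _))).topologicalClosure ≤ Hᗮ := by
    refine (Submodule.topologicalClosure_mono (Submodule.span_le.2 ?_)).trans
      (le_of_eq (Submodule.isClosed_orthogonal H).submodule_topologicalClosure_eq)
    rintro _ ⟨n, rfl⟩
    exact hall n
  rw [span_fourierLp_closure_eq_top (T := L) (by norm_num)] at hspan
  have htop : Hᗮ = ⊤ := top_le_iff.1 hspan
  rw [← Submodule.orthogonal_orthogonal H, htop, Submodule.top_orthogonal_eq_bot]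

end Rotations

/-! ### Lemma 6.2 (ii): rotation invariance of `Σ_μ 𝓔(𝒮^ev_0)` -/

/-- The rotation of (the class of) `Σ_μ 𝓔(f)` is `λ^{-1/2}` times (the class of) `Σ_μ 𝓔(ϑ(λ) f)`,
`a = log λ`; in particular it lies in the span of the generators (Lemma 6.2 (i)–(ii), p0018:L66–L77).
[cite: ConnesConsani2023, Lemma 6.2 (i)–(ii) (arXiv chunk p0018:L66–L77)] -/
theorem rotateLp_mem_zetaCycleRange_of_mem_generators {L : ℝ} [hL : Fact (0 < L)] (a : AddCircle L)
    {ξ : Lp ℂ 2 (@haarAddCircle L hL)} (hξ : ξ ∈ zetaCycleGenerators L) :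
    rotateLp L a ξ ∈ zetaCycleRange L := by
  obtain ⟨f, hf, hξf⟩ := hξ
  obtain ⟨a₀, rfl⟩ := QuotientAddGroup.mk_surjective a
  set lam : ℝ := Real.exp a₀ with hlam
  have hlam0 : 0 < lam := Real.exp_pos a₀
  have hsq : (Real.sqrt lam : ℂ) ≠ 0 :=
    ofReal_ne_zero.2 (Real.sqrt_pos.2 hlam0).ne'
  -- the candidate generator `η = √λ • R_a ξ`, a.e. equal to `Σ_μ 𝓔(ϑ(λ) f)`
  set η : Lp ℂ 2 (@haarAddCircle L hL) := (Real.sqrt lam : ℂ) • rotateLp L (a₀ : AddCircle L) ξ with hη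
  have hηae : (η : AddCircle L → ℂ) =ᵐ[haarAddCircle] sigmaE L (schwartzScale hlam0.ne' f) := by
    have h1 := Lp.coeFn_smul (Real.sqrt lam : ℂ) (rotateLp L (a₀ : AddCircle L) ξ)
    have h2 := coeFn_rotateLp (a₀ : AddCircle L) ξ
    have h3 := ae_eq_comp_rotate (L := L) (a₀ : AddCircle L) hξf
    filter_upwards [h1, h2, h3] with y hy1 hy2 hy3
    rw [hη, hy1, Pi.smul_apply, hy2, hy3, smul_eq_mul]
    induction y using QuotientAddGroup.induction_on with
    | H x =>
      have hx : -((a₀ : ℝ) : AddCircle L) + ((x : ℝ) : AddCircle L) = (((x - a₀ : ℝ)) : AddCircle L) := by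
        rw [QuotientAddGroup.mk_sub]; abel
      rw [hx, sigmaE_schwartzScale hlam0 L f x, hlam, Real.log_exp]
  have hηgen : η ∈ zetaCycleGenerators L := ⟨schwartzScale hlam0.ne' f, schwartzScale_mem_schwartzEv0 _ hf, hηae⟩
  have hrot : rotateLp L (a₀ : AddCircle L) ξ = (Real.sqrt lam : ℂ)⁻¹ • η := by
    rw [hη, smul_smul, inv_mul_cancel₀ hsq, one_smul]
  rw [hrot]
  exact Submodule.smul_mem _ _ (Submodule.subset_span hηgen)

/-- Rotations map `Σ_μ 𝓔(𝒮^ev_0)` into itself. [cite: ConnesConsani2023, Lemma 6.2 (ii) (arXiv chunk p0018:L69)] -/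
theorem rotateLp_mem_zetaCycleRange {L : ℝ} [hL : Fact (0 < L)] (a : AddCircle L)
    {u : Lp ℂ 2 (@haarAddCircle L hL)} (hu : u ∈ zetaCycleRange L) :
    rotateLp L a u ∈ zetaCycleRange L := by
  induction hu using Submodule.span_induction with
  | mem ξ hξ => exact rotateLp_mem_zetaCycleRange_of_mem_generators a hξ
  | zero => rw [map_zero]; exact Submodule.zero_mem _
  | add x y _ _ hx hy => rw [map_add]; exact Submodule.add_mem _ hx hy
  | smul c x _ hx => rw [map_smul]; exact Submodule.smul_mem _ c hx

/-- **Lemma 6.2 (ii)** (discharge of `CC2023_lemma_6_2_ii`): the scaling action induces an action of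
`C_μ` on `Σ_μ 𝓔(𝒮^ev_0)`: `R_a (Σ_μ 𝓔(𝒮^ev_0)) = Σ_μ 𝓔(𝒮^ev_0)` for every rotation `R_a`.  RH-FREE.
[cite: ConnesConsani2023, Lemma 6.2 (ii) (arXiv chunk p0018:L69)] -/
theorem CC2023_lemma_6_2_ii_holds : CC2023_lemma_6_2_ii := by
  intro L hL a
  apply le_antisymm
  · rintro _ ⟨u, hu, rfl⟩
    exact rotateLp_mem_zetaCycleRange a hu
  · intro u hu
    refine ⟨rotateLp L (-a) u, rotateLp_mem_zetaCycleRange (-a) hu, ?_⟩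
    show rotateLp L a (rotateLp L (-a) u) = u
    simpa only [neg_neg] using rotateLp_neg_rotateLp (-a) u

/-- `𝓗(L)` is rotation invariant. [cite: ConnesConsani2023, §6.2 (arXiv chunk p0020:L3)] -/
theorem rotateLp_mem_zetaCycleSpace {L : ℝ} [hL : Fact (0 < L)] (a : AddCircle L)
    {v : Lp ℂ 2 (@haarAddCircle L hL)} (hv : v ∈ zetaCycleSpace L) : rotateLp L a v ∈ zetaCycleSpace L :=
  rotateLp_mem_orthogonal (fun b _ hu => rotateLp_mem_zetaCycleRange b hu) a hv

/-! ### `𝓗(L)`, if nonzero, contains a character -/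

/-- If `𝓗(L) ≠ 0` then some character `e_n` lies in `𝓗(L)` (the eigenvector of the proof of
Corollary 6.5, p0020:L12, via Theorem 6.4 (i)'s decomposition into characters).
[cite: ConnesConsani2023, proof of Corollary 6.5 (arXiv chunk p0020:L11–L12)] -/
theorem exists_fourierLp_mem_zetaCycleSpace {L : ℝ} [hL : Fact (0 < L)] (hne : zetaCycleSpace L ≠ ⊥) :
    ∃ n : ℤ, (fourierLp 2 n : Lp ℂ 2 (@haarAddCircle L hL)) ∈ zetaCycleSpace L := by
  haveI : (zetaCycleSpace L).HasOrthogonalProjection := by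
    unfold zetaCycleSpace; infer_instance
  have hK : ∀ (a : AddCircle L), ∀ u ∈ (zetaCycleSpace L)ᗮ, rotateLp L a u ∈ (zetaCycleSpace L)ᗮ :=
    fun a _ hu => rotateLp_mem_orthogonal (fun b _ hv => rotateLp_mem_zetaCycleSpace b hv) a hu
  exact exists_fourierLp_mem_of_rotation_invariant (zetaCycleSpace L)
    (fun a _ hu => rotateLp_mem_zetaCycleSpace a hu) hK hne

end Literature.NumberTheory.ConnesConsani2023.ZetaCycles
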